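import Summits.RiemannHypothesis.RiemannHypothesis.Theorems.WeilGroundStateGroundStatesConvergeToXiExpClassHarmonic
import Summits.RiemannHypothesis.RiemannHypothesis.Theorems.WeilGroundStateGroundStatesConvergeToXiStubDoobPrime
import Summits.RiemannHypothesis.RiemannHypothesis.Theorems.WeilGroundStateGroundStatesConvergeToXiStubDoobArch
import Summits.RiemannHypothesis.RiemannHypothesis.Theorems.WeilGroundStateGroundStatesConvergeToXiStubDoobPolar
import Summits.RiemannHypothesis.RiemannHypothesis.Theorems.WeilGroundStateGroundStatesConvergeToXiStubGaussianExpClass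
import Summits.RiemannHypothesis.RiemannHypothesis.Theorems.WeilGroundStateGroundStatesConvergeToXiStubDoobKernelSign
import Summits.RiemannHypothesis.RiemannHypothesis.Theorems.WeilGroundStateGroundStatesConvergeToXiStubTightWeakOfWeightedL2Limit
import Summits.RiemannHypothesis.RiemannHypothesis.Theorems.WeilGroundStateGroundStatesConvergeToXiTransfer
import Summits.RiemannHypothesis.RiemannHypothesis.Theorems.WeilGroundStateGroundStatesConvergeToXiEnergyUpperTail
import Summits.RiemannHypothesis.RiemannHypothesis.Theses.WeilGroundState
import Summits.RiemannHypothesis.RiemannHypothesis.Theorems.GroundStatesConvergeToXi.Negative.NotAttained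
import Literature.NumberTheory.LFunctions.WeilExplicit
import Literature.NumberTheory.LFunctions.WeilExplicitArchTermProofs
import Literature.NumberTheory.LFunctions.WeilMarkovQuadratic
import Literature.NumberTheory.LFunctions.WeilZeroSum
import HarnessLib

/-!
# `WeilGroundState.GroundStatesConvergeToXi` — the Doob / ground-state-transform identity for
Weil's quadratic form conjugated by Riemann's kernel (crux item stmt-RiemannHypothesis-1527, route
route-RiemannHypothesis-WeilGroundState; line `Sketch`, lead c8, wave 2; `--supports`; RH-free)

Riemann's kernel `Φ(t) = 2Ψ(2t)` (`Φ̂ = ξ`) is Weil-harmonic (`phi_translate_harmonic`,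
`…ExpClassHarmonic.lean`): the prime + archimedean Weil operator maps it to the polar eigenfunction,
`weilPrimeTerm (τ_xΦ) − weilArchTermBombieri (τ_xΦ) = cosh(x/2)`, and `∫Φ cosh(t/2) = 1/2`,
`∫Φ sinh(t/2) = 0`.  Conjugating Weil's hermitian form by `Φ` (ground-state / Doob transform,
`u = Φ·w`) therefore kills the killing constant and the rank-two pole form EXACTLY:

* `stub_doob_identity` / `doob_identity` — **THE DOOB IDENTITY**: for every test function `w`,
  `Re Q(Φw) = Σ_n Λ(n) n^{-1/2} I_w(log n) + ∫₀^∞ e^{h/2}/(2 sinh h) I_w(h) dh − ∫₀^∞ 2cosh(h/2) I_w(h) dh`,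
  `I_w(h) = ∫ Φ(t) Φ(t+h) ‖w(t+h) − w(t)‖² dt ≥ 0`: Weil's form in the variable `w = u/Φ` is the
  jump form `½∬ J(s−t) Φ(s)Φ(t) ‖w(s) − w(t)‖²` of the SIGNED Lévy kernel
  `J = Σ_n Λ(n) n^{-1/2} δ_{±log n} + e^{|h|/2}/(2 sinh|h|) − 2cosh(h/2)` — no killing constant
  `M_a`, no pole form, no renormalisation at `h = 0` (assembly of the registered stubs
  `stub_doob_prime` (D1), `stub_doob_arch` (D2), `stub_doob_polar` (D3) with
  `weilPrimeTerm_sub_weilArchTermBombieri_phi_translate`).  First lemma (`DoobIdentity`) of the crux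
  idea card `xi-kernel-doob-transform`, numerically certified to `9.4e-20` in job j015519, now a
  theorem.  In these variables the crux's limit object is the CONSTANT `w ≡ 1` and the windowed
  minimisation is the part form of `½∬ J Φ⊗Φ |Δw|²` on `[-a, a]` in `L²(Φ² dt)`.
* `doobKernel_pos`, `doobKernel_neg` — the sign structure of the archimedean–polar kernel
  `e^{h/2}/(2 sinh h) − 2cosh(h/2)`: positive on `(0, 1/4]`, negative on `[1/3, ∞)` (sign change at
  `h* = log x*`, `x*³ = x* + 1` the plastic number, `h* ≈ 0.2812`; `stub_doobKernel_sign`, E3).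
* `groundStatesConvergeToXi_of_weightedL2Limit` — **the card's transfer is honest**: weighted-`L²`
  convergence `∫‖c_k u_k − Φ‖² e^{(1+δ)|t|} → 0` of renormalised ground states along `a_k → ∞`
  implies the crux (`stub_tightWeak_of_weightedL2Limit`, E4, gives (T) and (W); then the landed
  transfer `groundStatesConvergeToXi_of_tightWeakLimit`, p97820).
* `explicit_formula_gaussian` — the explicit formula with GAUSSIAN test functions `e^{-ct²}`,
  `c > 0` (a member of the exponential Weil class; `stub_gaussian_expClass`, E1, with
  `explicit_formula_expClass'`).
No new definitions.
-/

noncomputable section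

set_option linter.dupNamespace false

open scoped Topology Real ComplexConjugate ArithmeticFunction.vonMangoldt
open Filter Set MeasureTheory Complex

namespace Summit.RiemannHypothesis.RiemannHypothesis.Theorems.GroundStatesConvergeToXi

open Literature.NumberTheory.LFunctions

/-! ## The Doob identity -/

/-- **The Doob / ground-state-transform identity (RH-free)**: for every Weil test function `w`,
`Re Q(Φ·w) = Σ_n Λ(n) n^{-1/2} I_w(log n) + ∫₀^∞ e^{h/2}/(2 sinh h) · I_w(h) dh − ∫₀^∞ 2cosh(h/2) · I_w(h) dh`
with the `Φ`-weighted jump energies `I_w(h) = ∫ Φ(t)Φ(t+h)‖w(t+h) − w(t)‖² dt`.  Proof: by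
`Re Q(u) = P(u) + Re(−prime k + arch_B k)` (`k = u ⋆ ũ`, Bombieri's archimedean form), the prime and
archimedean splittings `stub_doob_prime` / `stub_doob_arch` through the pairing of
`g_w = Φ‖w‖²` with `x ↦ weilPrimeTerm (τ_xΦ)`, `x ↦ weilArchTermBombieri (τ_xΦ)`, the pointwise
identity `(prime − arch_B)(τ_xΦ) = cosh(x/2)` under the integral, and the polar splitting
`stub_doob_polar`: `P(Φw) − ∫ g_w cosh(x/2) = −∫₀^∞ 2cosh(h/2) I_w`. [folklore] -/
theorem doob_identity {w : ℝ → ℂ} (hw : IsWeilTest w) :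
    (weilQuadratic (fun t : ℝ => (2 : ℂ) * LagariasMontague.Psic (2 * t) * w t)).re =
      (∑' n : ℕ, (Λ n : ℝ) / Real.sqrt n *
        ∫ t : ℝ, 2 * LagariasMontague.Psi (2 * t) * (2 * LagariasMontague.Psi (2 * (t + Real.log n))) *
          ‖w (t + Real.log n) - w t‖ ^ 2) +
      (∫ h in Ioi (0 : ℝ), Real.exp (h / 2) / (2 * Real.sinh h) *
        ∫ t : ℝ, 2 * LagariasMontague.Psi (2 * t) * (2 * LagariasMontague.Psi (2 * (t + h))) *
          ‖w (t + h) - w t‖ ^ 2) -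
      (∫ h in Ioi (0 : ℝ), 2 * Real.cosh (h / 2) *
        ∫ t : ℝ, 2 * LagariasMontague.Psi (2 * t) * (2 * LagariasMontague.Psi (2 * (t + h))) *
          ‖w (t + h) - w t‖ ^ 2) := by
  set u : ℝ → ℂ := fun t : ℝ => (2 : ℂ) * LagariasMontague.Psic (2 * t) * w t with hu_def
  have hu : IsWeilTest u := ⟨contDiff_phi.mul hw.1, hw.2.mul_left⟩
  obtain ⟨-, hPi, hP⟩ := stub_doob_prime w hw
  obtain ⟨-, hAi, hA⟩ := stub_doob_arch w hw
  obtain ⟨-, -, hpol⟩ := stub_doob_polar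
  obtain ⟨-, hPol⟩ := hpol w hw
  -- `Re Q(u) = P(u) + Re(−prime k + arch_B k)`
  have hk : IsWeilTest (weilConv u (weilReflect u)) := hu.weilConv hu.weilReflect
  have h1 : (weilQuadratic u).re = weilPoleForm u +
      (-(weilPrimeTerm (weilConv u (weilReflect u))) +
        weilArchTermBombieri (weilConv u (weilReflect u))).re := by
    rw [weilQuadratic_re_eq_weilPoleForm_add, weilMarkovQuadratic_eq_re hu,
      ← weilArchTermBombieri_eq_weilArchTerm_holds hk]
    simp only [Complex.add_re, Complex.neg_re]
  -- the pairing `⟨g_w, (prime − arch_B)(τ_xΦ)⟩ = ∫ g_w cosh(x/2)`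
  have hpair : (∫ x : ℝ, ((2 * LagariasMontague.Psi (2 * x) * ‖w x‖ ^ 2 : ℝ) : ℂ) *
        weilPrimeTerm (fun t : ℝ => (2 : ℂ) * LagariasMontague.Psic (2 * (t + x)))) -
      (∫ x : ℝ, ((2 * LagariasMontague.Psi (2 * x) * ‖w x‖ ^ 2 : ℝ) : ℂ) *
        weilArchTermBombieri (fun t : ℝ => (2 : ℂ) * LagariasMontague.Psic (2 * (t + x)))) =
      ((∫ x : ℝ, 2 * LagariasMontague.Psi (2 * x) * ‖w x‖ ^ 2 * Real.cosh (x / 2) : ℝ) : ℂ) := by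
    rw [← integral_sub hPi hAi, ← integral_complex_ofReal]
    refine integral_congr_ae (ae_of_all _ fun x => ?_)
    dsimp only
    rw [← mul_sub, weilPrimeTerm_sub_weilArchTermBombieri_phi_translate x]
    push_cast
    ring
  rw [h1, hP, hA]
  have e2 : weilPoleForm u = (∫ x : ℝ, 2 * LagariasMontague.Psi (2 * x) * ‖w x‖ ^ 2 * Real.cosh (x / 2)) -
      (∫ h in Ioi (0 : ℝ), 2 * Real.cosh (h / 2) *
        ∫ t : ℝ, 2 * LagariasMontague.Psi (2 * t) * (2 * LagariasMontague.Psi (2 * (t + h))) *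
          ‖w (t + h) - w t‖ ^ 2) := by linarith [hPol]
  have e3 : (-((∫ x : ℝ, ((2 * LagariasMontague.Psi (2 * x) * ‖w x‖ ^ 2 : ℝ) : ℂ) *
          weilPrimeTerm (fun t : ℝ => (2 : ℂ) * LagariasMontague.Psic (2 * (t + x)))) -
        ((∑' n : ℕ, (Λ n : ℝ) / Real.sqrt n *
          ∫ t : ℝ, 2 * LagariasMontague.Psi (2 * t) * (2 * LagariasMontague.Psi (2 * (t + Real.log n))) *
            ‖w (t + Real.log n) - w t‖ ^ 2 : ℝ) : ℂ)) +
      ((∫ x : ℝ, ((2 * LagariasMontague.Psi (2 * x) * ‖w x‖ ^ 2 : ℝ) : ℂ) *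
          weilArchTermBombieri (fun t : ℝ => (2 : ℂ) * LagariasMontague.Psic (2 * (t + x)))) +
        ((∫ h in Ioi (0 : ℝ), Real.exp (h / 2) / (2 * Real.sinh h) *
          ∫ t : ℝ, 2 * LagariasMontague.Psi (2 * t) * (2 * LagariasMontague.Psi (2 * (t + h))) *
            ‖w (t + h) - w t‖ ^ 2 : ℝ) : ℂ))).re =
      -(∫ x : ℝ, 2 * LagariasMontague.Psi (2 * x) * ‖w x‖ ^ 2 * Real.cosh (x / 2)) +
      (∑' n : ℕ, (Λ n : ℝ) / Real.sqrt n *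
          ∫ t : ℝ, 2 * LagariasMontague.Psi (2 * t) * (2 * LagariasMontague.Psi (2 * (t + Real.log n))) *
            ‖w (t + Real.log n) - w t‖ ^ 2) +
      (∫ h in Ioi (0 : ℝ), Real.exp (h / 2) / (2 * Real.sinh h) *
          ∫ t : ℝ, 2 * LagariasMontague.Psi (2 * t) * (2 * LagariasMontague.Psi (2 * (t + h))) *
            ‖w (t + h) - w t‖ ^ 2) := by
    have : ∀ (Pp Aa : ℂ) (S R : ℝ), (-(Pp - (S : ℂ)) + (Aa + (R : ℂ))).re = -((Pp - Aa).re) + S + R := by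
      intro Pp Aa S R
      simp only [Complex.add_re, Complex.neg_re, Complex.sub_re, Complex.ofReal_re]
      ring
    rw [this, hpair, Complex.ofReal_re]
  rw [e3, e2]
  ring

/-- **The Doob identity, registered uncurried form (stub D4 of line `Sketch`).** [folklore] -/
theorem stub_doob_identity :
    ∀ w : ℝ → ℂ, IsWeilTest w →
      (weilQuadratic (fun t : ℝ => (2 : ℂ) * LagariasMontague.Psic (2 * t) * w t)).re =
        (∑' n : ℕ, (Λ n : ℝ) / Real.sqrt n *
          ∫ t : ℝ, 2 * LagariasMontague.Psi (2 * t) * (2 * LagariasMontague.Psi (2 * (t + Real.log n))) *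
            ‖w (t + Real.log n) - w t‖ ^ 2) +
        (∫ h in Ioi (0 : ℝ), Real.exp (h / 2) / (2 * Real.sinh h) *
          ∫ t : ℝ, 2 * LagariasMontague.Psi (2 * t) * (2 * LagariasMontague.Psi (2 * (t + h))) *
            ‖w (t + h) - w t‖ ^ 2) -
        (∫ h in Ioi (0 : ℝ), 2 * Real.cosh (h / 2) *
          ∫ t : ℝ, 2 * LagariasMontague.Psi (2 * t) * (2 * LagariasMontague.Psi (2 * (t + h))) *
            ‖w (t + h) - w t‖ ^ 2) :=
  fun _ hw => doob_identity hw

/-- **The jump energies are non-negative**: `I_w(h) ≥ 0` (`Ψ > 0` on `ℝ`: every theta term is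
positive, `Negative.Psi_pos_of_nonneg`, and `Ψ` is even). [folklore] -/
theorem doobJumpEnergy_nonneg (w : ℝ → ℂ) (h : ℝ) :
    0 ≤ ∫ t : ℝ, 2 * LagariasMontague.Psi (2 * t) * (2 * LagariasMontague.Psi (2 * (t + h))) *
      ‖w (t + h) - w t‖ ^ 2 := by
  have hpsi : ∀ x : ℝ, 0 ≤ LagariasMontague.Psi x := fun x => by
    rcases le_or_gt 0 x with hx | hx
    · exact (Negative.Psi_pos_of_nonneg hx).le
    · rw [← LagariasMontague.Psi_neg]
      exact (Negative.Psi_pos_of_nonneg (by linarith)).le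
  refine integral_nonneg fun t => ?_
  have h1 := hpsi (2 * t)
  have h2 := hpsi (2 * (t + h))
  positivity

/-! ## The sign of the archimedean–polar kernel -/

/-- **Short range: the Doob kernel is positive**, `2cosh(h/2) < e^{h/2}/(2 sinh h)` for
`0 < h ≤ 1/4` (the `1/(2h)` singularity of the archimedean jump density beats the polar rate).
[folklore] -/
theorem doobKernel_pos {h : ℝ} (h0 : 0 < h) (h1 : h ≤ 1 / 4) :
    2 * Real.cosh (h / 2) < Real.exp (h / 2) / (2 * Real.sinh h) :=
  stub_doobKernel_sign.1 h h0 h1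

/-- **Long range: the Doob kernel is negative**, `e^{h/2}/(2 sinh h) < 2cosh(h/2)` for `h ≥ 1/3`;
in particular at every prime length `log n ≥ log 2`. [folklore] -/
theorem doobKernel_neg {h : ℝ} (h1 : 1 / 3 ≤ h) :
    Real.exp (h / 2) / (2 * Real.sinh h) < 2 * Real.cosh (h / 2) :=
  stub_doobKernel_sign.2 h h1

/-- The Doob kernel is negative at every prime-power length `log n`, `n ≥ 2`. [folklore] -/
theorem doobKernel_neg_log {n : ℕ} (hn : 2 ≤ n) :
    Real.exp (Real.log n / 2) / (2 * Real.sinh (Real.log n)) < 2 * Real.cosh (Real.log n / 2) := by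
  refine doobKernel_neg ?_
  have h2 : Real.log 2 ≤ Real.log n :=
    Real.log_le_log (by norm_num) (by exact_mod_cast hn)
  have := Real.log_two_gt_d9
  linarith

/-! ## The weighted-`L²` transfer of card `xi-kernel-doob-transform` -/

/-- **Weighted-`L²` convergence of renormalised ground states to Riemann's kernel implies the crux
(RH-free).**  If along some windows `a_k → ∞` there are ground states `u_k` and constants `c_k ≠ 0`
with `∫ ‖c_k u_k − Φ‖² e^{(1+δ)|t|} dt → 0` for some `δ > 0`, then `GroundStatesConvergeToXi` holds:
the weight gives (T) tightness in every `L¹(e^{b|t|})`, `b < 1/2`, and (W) weak convergence to `Φ`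
(`stub_tightWeak_of_weightedL2Limit`), and the transfer `groundStatesConvergeToXi_of_tightWeakLimit`
concludes.  This is the `transfer_statement` of the crux idea card `xi-kernel-doob-transform`
(`C⁺ ⇒ crux`), now honest in the tree. [folklore] -/
theorem groundStatesConvergeToXi_of_weightedL2Limit
    (h : ∃ δ : ℝ, 0 < δ ∧ ∃ a : ℕ → ℝ, ∃ u : ℕ → ℝ → ℂ, ∃ c : ℕ → ℂ,
      Tendsto a atTop atTop ∧ (∀ k, c k ≠ 0) ∧ (∀ k, IsWeilGroundState (a k) (u k)) ∧
      Tendsto (fun k => ∫ t, ‖c k * u k t - (2 : ℂ) * LagariasMontague.Psic (2 * t)‖ ^ 2 *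
        Real.exp ((1 + δ) * |t|)) atTop (𝓝 0)) :
    Summit.RiemannHypothesis.RiemannHypothesis.Theses.WeilGroundState.GroundStatesConvergeToXi := by
  obtain ⟨δ, hδ, a, u, c, ha, hc, hu, hlim⟩ := h
  obtain ⟨htight, hweak⟩ := stub_tightWeak_of_weightedL2Limit δ a u c hδ hu hlim
  exact groundStatesConvergeToXi_of_tightWeakLimit ⟨a, u, c, ha, hc, hu, htight, hweak⟩

/-! ## The explicit formula with Gaussian test functions -/

/-- **The explicit formula for Gaussians (RH-free)**: for every `c > 0`, with `g_c(t) = e^{-ct²}`,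
`Σ'_ρ m(ρ) ĝ_c(ρ) = W(g_c)`, the zero side converging absolutely, also as the symmetric limit
`HasWeilZeroSide g_c (W g_c)` (`g_c` lies in the exponential Weil class, `stub_gaussian_expClass`;
the class explicit formula `explicit_formula_expClass'`). [folklore] -/
theorem explicit_formula_gaussian {c : ℝ} (hc : 0 < c) :
    Summable (fun ρ : ZetaZeros.riemannZetaNontrivialZeros =>
        ‖(riemannZetaZeroOrder (ρ : ℂ) : ℂ) * weilMellin (fun t : ℝ => (Real.exp (-(c * t ^ 2)) : ℂ)) ρ‖) ∧
    HasWeilZeroSide (fun t : ℝ => (Real.exp (-(c * t ^ 2)) : ℂ))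
      (weilFunctional (fun t : ℝ => (Real.exp (-(c * t ^ 2)) : ℂ))) ∧
    ∑' ρ : ZetaZeros.riemannZetaNontrivialZeros,
        (riemannZetaZeroOrder (ρ : ℂ) : ℂ) * weilMellin (fun t : ℝ => (Real.exp (-(c * t ^ 2)) : ℂ)) ρ =
      weilFunctional (fun t : ℝ => (Real.exp (-(c * t ^ 2)) : ℂ)) :=
  (stub_gaussian_expClass explicit_formula_expClass' c hc).2.2

end Summit.RiemannHypothesis.RiemannHypothesis.Theorems.GroundStatesConvergeToXi

end
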